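import Mathlib
import HarnessLib
import Summits.RiemannHypothesis.RiemannHypothesis.Theorems.DbrWallAntipersistenceLogFive
import Summits.RiemannHypothesis.RiemannHypothesis.Theorems.DbrWallLogSevenBounds

/-!
# DBR column, rung B-P(P1): anti-persistence of the zeta screw line through its hardest certified mesh —
# `Ψ(2s) < 2Ψ(s)` for every `0 < s ≤ (log 7)/2`

RH-FREE calculus inequality (LINE 1 of the label discipline): a theorem about the closed form (1.1) of Suzuki's
screw function `Ψ = Literature.NumberTheory.LFunctions.zetaScrew` with its prime terms `Λ(n)n^{−1/2}(t − log n)₊`,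
`n ≤ 7`; NOT worded as, and not, progress toward RH («`Ψ(2s) < 2Ψ(s)` for all `s > 0`» stays a conjecture from data).

Fifth step of the ladder (`DbrWallAntipersistence` → `…Prime` → `…LogTwo` → `…LogFive` → here): the piece
`[(log 5)/2, (log 7)/2]`, where `φ(2s)` carries the prime powers `2, 3, 4, 5` (`Λ(6) = 0`) and `φ(s)` carries `2`
(`two_mul_zetaScrew_sub_eq_gap_add_four_primes`), with the certificate at `s₁ = (log 7)/2`
(`gap_add_primes_half_log_seven_pos`: `ρ = 7^{1/4}`, `1.626576 < ρ < 1.626577`, `e^{−λ'_k s₁} = ρ⁻¹7^{−(k+1)}`;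
twenty terms `≥ 0.25909` + tail `≥ (1−7^{−21})²/85`, `4(ρ−1)² < 1.570395`; prime terms
`(log 2)²/√2 + (log 3/√3)·log(7/3) + (log 2/2)·log(7/4) + (log 5/√5)·log(7/5) > 1.3132` from series bounds
`log(7/3) > 0.8472977`, `log(7/4) > 0.5596157`, `log(7/5) > 0.3364721`, `log 5 = 2 log 2 + log(5/4) > 1.609436`,
`√5 < 2.23607`; numerically `F((log 7)/2) = 0.01403` — the SMALLEST value of `F = 2Ψ(s) − Ψ(2s)` on the cell's mesh
scan `[0.004, 6]` (kit j250362: `κ₁` minimal at `(log 7)/2`) — certificate margin `0.0137`). Result: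
`zetaScrew_two_mul_lt_two_mul_of_le_half_log_seven` — **`Ψ(2s) < 2Ψ(s)` for every mesh `0 < s ≤ (log 7)/2`**.
Nothing here bears on the truth of RH.
References: M. Suzuki, J. Lond. Math. Soc. (2) 108 (2023) = arXiv:2206.03682, (1.1) [Suzuki2023]. -/

set_option linter.dupNamespace false

noncomputable section

open scoped BigOperators
open Set
namespace Summit.RiemannHypothesis.RiemannHypothesis.Theorems.DbrWall

open Literature.NumberTheory.LFunctions

/-! ### The prime sum on `log 5 ≤ t ≤ log 7` -/

/-- For `log 5 ≤ t ≤ log 7`: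
`φ(t) = (log 2/√2)(t − log 2) + (log 3/√3)(t − log 3) + (log 2/2)(t − log 4) + (log 5/√5)(t − log 5)`
(`Λ(4) = log 2`, `√4 = 2`, `Λ(6) = 0`). [cite: Suzuki2023, (1.1)] -/
theorem zetaScrewPrimeSum_eq_of_log_five_le {t : ℝ} (h5 : Real.log 5 ≤ t) (h7 : t ≤ Real.log 7) :
    zetaScrewPrimeSum t = Real.log 2 / Real.sqrt 2 * (t - Real.log 2)
      + Real.log 3 / Real.sqrt 3 * (t - Real.log 3) + Real.log 2 / 2 * (t - Real.log 4)
      + Real.log 5 / Real.sqrt 5 * (t - Real.log 5) := by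
  have h23 : Real.log 2 < Real.log 3 := Real.log_lt_log (by norm_num) (by norm_num)
  have h34 : Real.log 3 < Real.log 4 := Real.log_lt_log (by norm_num) (by norm_num)
  have h45 : Real.log 4 < Real.log 5 := Real.log_lt_log (by norm_num) (by norm_num)
  have ht0 : 0 < t := lt_of_lt_of_le (Real.log_pos (by norm_num : (1:ℝ) < 5)) h5
  have hM : Real.exp |t| ≤ ((7 : ℕ) : ℝ) := by
    rw [abs_of_pos ht0]
    calc Real.exp t ≤ Real.exp (Real.log 7) := Real.exp_le_exp.2 h7
      _ = 7 := Real.exp_log (by norm_num)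
      _ = ((7 : ℕ) : ℝ) := by norm_num
  rw [zetaScrewPrimeSum_eq_sum_max hM, abs_of_pos ht0,
    show Finset.Icc (1 : ℕ) 7 = {1, 2, 3, 4, 5, 6, 7} from by decide,
    Finset.sum_insert (by decide), Finset.sum_insert (by decide), Finset.sum_insert (by decide),
    Finset.sum_insert (by decide), Finset.sum_insert (by decide), Finset.sum_insert (by decide),
    Finset.sum_singleton]
  have h1 : ArithmeticFunction.vonMangoldt 1 = 0 := ArithmeticFunction.vonMangoldt_apply_one
  have hΛ2 : ArithmeticFunction.vonMangoldt 2 = Real.log 2 := by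
    rw [ArithmeticFunction.vonMangoldt_apply_prime Nat.prime_two]; norm_num
  have hΛ3 : ArithmeticFunction.vonMangoldt 3 = Real.log 3 := by
    rw [ArithmeticFunction.vonMangoldt_apply_prime Nat.prime_three]; norm_num
  have hΛ4 : ArithmeticFunction.vonMangoldt 4 = Real.log 2 := by
    rw [show (4 : ℕ) = 2 ^ 2 by norm_num, ArithmeticFunction.vonMangoldt_apply_pow two_ne_zero,
      ArithmeticFunction.vonMangoldt_apply_prime Nat.prime_two]; norm_num
  have hΛ5 : ArithmeticFunction.vonMangoldt 5 = Real.log 5 := by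
    rw [ArithmeticFunction.vonMangoldt_apply_prime Nat.prime_five]; norm_num
  have hΛ6 : ArithmeticFunction.vonMangoldt 6 = 0 :=
    ArithmeticFunction.vonMangoldt_eq_zero_iff.2 (by decide)
  have hs4 : Real.sqrt ((4 : ℕ) : ℝ) = 2 := by
    rw [show ((4 : ℕ) : ℝ) = 2 ^ 2 by norm_num, Real.sqrt_sq (by norm_num)]
  have hm2 : max (t - Real.log ((2 : ℕ) : ℝ)) 0 = t - Real.log 2 := by
    push_cast; exact max_eq_left (by linarith)
  have hm3 : max (t - Real.log ((3 : ℕ) : ℝ)) 0 = t - Real.log 3 := by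
    push_cast; exact max_eq_left (by linarith)
  have hm4 : max (t - Real.log ((4 : ℕ) : ℝ)) 0 = t - Real.log 4 := by
    push_cast; exact max_eq_left (by linarith)
  have hm5 : max (t - Real.log ((5 : ℕ) : ℝ)) 0 = t - Real.log 5 := by
    push_cast; exact max_eq_left (by linarith)
  have hm7 : max (t - Real.log ((7 : ℕ) : ℝ)) 0 = 0 := by
    push_cast; exact max_eq_right (by linarith)
  rw [h1, hΛ2, hΛ3, hΛ4, hΛ5, hΛ6, hs4, hm2, hm3, hm4, hm5, hm7]
  push_cast
  ring

/-- **Two-point identity on `[(log 5)/2, (log 7)/2]`**: for `log 5 ≤ 2s ≤ log 7`,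
`2Ψ(s) − Ψ(2s) = D(s) + (log 2/√2)(2s − log 2) + (log 3/√3)(2s − log 3) + (log 2/2)(2s − log 4)
  + (log 5/√5)(2s − log 5) − 2(log 2/√2)(s − log 2)`. [folklore] -/
theorem two_mul_zetaScrew_sub_eq_gap_add_four_primes {s : ℝ} (h5 : Real.log 5 ≤ 2 * s)
    (h7 : 2 * s ≤ Real.log 7) :
    2 * zetaScrew s - zetaScrew (2 * s) =
      (∑' k : ℕ, (1 - Real.exp (-((2 * (k : ℝ) + 5 / 2) * s))) ^ 2 / (2 * (k : ℝ) + 5 / 2) ^ 2)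
      - 4 * (Real.exp (s / 2) - 1) ^ 2 + Real.log 2 / Real.sqrt 2 * (2 * s - Real.log 2)
      + Real.log 3 / Real.sqrt 3 * (2 * s - Real.log 3) + Real.log 2 / 2 * (2 * s - Real.log 4)
      + Real.log 5 / Real.sqrt 5 * (2 * s - Real.log 5)
      - 2 * (Real.log 2 / Real.sqrt 2 * (s - Real.log 2)) := by
  have hl2 : 0 < Real.log 2 := Real.log_pos one_lt_two
  have h45 : 2 * Real.log 2 < Real.log 5 := by
    have h' : Real.log 4 < Real.log 5 := Real.log_lt_log (by norm_num) (by norm_num)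
    have h4 : Real.log 4 = 2 * Real.log 2 := by
      rw [show (4 : ℝ) = 2 ^ 2 by norm_num, Real.log_pow]; norm_num
    linarith
  have h79 : Real.log 7 < 2 * Real.log 3 := by
    have h' : Real.log 7 < Real.log 9 := Real.log_lt_log (by norm_num) (by norm_num)
    have h9 : Real.log 9 = 2 * Real.log 3 := by
      rw [show (9 : ℝ) = 3 ^ 2 by norm_num, Real.log_pow]; norm_num
    linarith
  have hs0 : 0 ≤ s := by linarith
  have hs2 : Real.log 2 ≤ s := by linarith
  have hs3 : s ≤ Real.log 3 := by linarith
  rw [two_mul_zetaScrew_sub_eq_gap_add_primeSums hs0, zetaScrewPrimeSum_eq_of_log_five_le h5 h7,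
    zetaScrewPrimeSum_eq_of_log_two_le hs2 hs3]
  ring

/-! ### The certificate at `s₁ = (log 7)/2` (constants from `DbrWallLogSevenBounds`) -/

/-- **`F((log 7)/2) > 0`**: the two-point gap at the hardest certified mesh (numerically `F = −1.2993 + 1.3133 =
0.0140`) in certificate form. [folklore] -/
theorem gap_add_primes_half_log_seven_pos :
    0 < (∑' k : ℕ, (1 - Real.exp (-((2 * (k : ℝ) + 5 / 2) * (Real.log 7 / 2)))) ^ 2
            / (2 * (k : ℝ) + 5 / 2) ^ 2)
        - 4 * (Real.exp (Real.log 7 / 2 / 2) - 1) ^ 2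
        + Real.log 2 / Real.sqrt 2 * (2 * (Real.log 7 / 2) - Real.log 2)
        + Real.log 3 / Real.sqrt 3 * (2 * (Real.log 7 / 2) - Real.log 3)
        + Real.log 2 / 2 * (2 * (Real.log 7 / 2) - Real.log 4)
        + Real.log 5 / Real.sqrt 5 * (2 * (Real.log 7 / 2) - Real.log 5)
        - 2 * (Real.log 2 / Real.sqrt 2 * (Real.log 7 / 2 - Real.log 2)) := by
  set r := Real.exp (Real.log 7 / 4) with hr
  have hr0 : 0 < r := Real.exp_pos _
  obtain ⟨hr4, hr_lo, hr_hi⟩ := exp_log_seven_div_four_bounds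
  have hrinv : r⁻¹ ≤ 0.61479 := by
    rw [inv_eq_one_div, div_le_iff₀ hr0]; nlinarith
  have hrinv1 : r⁻¹ ≤ 1 := by
    rw [inv_eq_one_div, div_le_iff₀ hr0]; nlinarith
  have hrinv0 : 0 ≤ r⁻¹ := by positivity
  have hs0 : (0 : ℝ) ≤ Real.log 7 / 2 := by
    have := Real.log_nonneg (show (1 : ℝ) ≤ 7 by norm_num); positivity
  rw [show Real.log 7 / 2 / 2 = Real.log 7 / 4 by ring]
  simp only [exp_neg_lam_mul_half_log_seven]
  have hS : Summable fun k : ℕ =>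
      (1 - (1 / 7 : ℝ) ^ (k + 1) * r⁻¹) ^ 2 / (2 * (k : ℝ) + 5 / 2) ^ 2 := by
    have := summable_gap_terms hs0
    simp only [exp_neg_lam_mul_half_log_seven] at this
    exact this
  rw [← hS.sum_add_tsum_nat_add 20]
  have hterm : ∀ k : ℕ, (1 - (1 / 7 : ℝ) ^ (k + 1) * 0.61479) ^ 2 / (2 * (k : ℝ) + 5 / 2) ^ 2
      ≤ (1 - (1 / 7 : ℝ) ^ (k + 1) * r⁻¹) ^ 2 / (2 * (k : ℝ) + 5 / 2) ^ 2 := by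
    intro k
    apply div_le_div_of_nonneg_right _ (by positivity)
    have hq0 : 0 ≤ (1 / 7 : ℝ) ^ (k + 1) := by positivity
    have hq1 : (1 / 7 : ℝ) ^ (k + 1) ≤ 1 := pow_le_one₀ (by norm_num) (by norm_num)
    have hlo : 0 ≤ 1 - (1 / 7 : ℝ) ^ (k + 1) * 0.61479 := by nlinarith
    have hle : 1 - (1 / 7 : ℝ) ^ (k + 1) * 0.61479 ≤ 1 - (1 / 7 : ℝ) ^ (k + 1) * r⁻¹ := by
      nlinarith [mul_le_mul_of_nonneg_left hrinv hq0]
    exact pow_le_pow_left₀ hlo hle 2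
  have hnum : (0.25909 : ℝ) ≤
      ∑ k ∈ Finset.range 20, (1 - (1 / 7 : ℝ) ^ (k + 1) * 0.61479) ^ 2 / (2 * (k : ℝ) + 5 / 2) ^ 2 := by
    simp only [Finset.sum_range_succ, Finset.sum_range_zero]
    norm_num
  have hhead : (0.25909 : ℝ) ≤
      ∑ k ∈ Finset.range 20, (1 - (1 / 7 : ℝ) ^ (k + 1) * r⁻¹) ^ 2 / (2 * (k : ℝ) + 5 / 2) ^ 2 :=
    hnum.trans (Finset.sum_le_sum fun k _ => hterm k)
  have hT := Literature.Probability.LatticeModels.hasSum_telescope (show (0 : ℝ) < 85 / 4 by norm_num)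
  have hTs : Summable fun k : ℕ =>
      (1 - (1 / 7 : ℝ) ^ 21) ^ 2 / 4 * (1 / (((k : ℝ) + 85 / 4) * ((k : ℝ) + 85 / 4 + 1))) :=
    (hT.mul_left _).summable
  have hTval : ∑' k : ℕ, (1 - (1 / 7 : ℝ) ^ 21) ^ 2 / 4 * (1 / (((k : ℝ) + 85 / 4) * ((k : ℝ) + 85 / 4 + 1)))
      = (1 - (1 / 7 : ℝ) ^ 21) ^ 2 / 4 * (1 / (85 / 4)) := (hT.mul_left _).tsum_eq
  have htail : ∑' k : ℕ, (1 - (1 / 7 : ℝ) ^ 21) ^ 2 / 4 * (1 / (((k : ℝ) + 85 / 4) * ((k : ℝ) + 85 / 4 + 1)))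
      ≤ ∑' k : ℕ, (1 - (1 / 7 : ℝ) ^ (k + 20 + 1) * r⁻¹) ^ 2 / (2 * ((k + 20 : ℕ) : ℝ) + 5 / 2) ^ 2 := by
    refine hTs.tsum_le_tsum (fun k => ?_) ((summable_nat_add_iff 20).2 hS)
    have hq0 : 0 ≤ (1 / 7 : ℝ) ^ (k + 20 + 1) * r⁻¹ := by positivity
    have hq1 : (1 / 7 : ℝ) ^ (k + 20 + 1) * r⁻¹ ≤ (1 / 7 : ℝ) ^ 21 := by
      have h1 : (1 / 7 : ℝ) ^ (k + 20 + 1) ≤ (1 / 7 : ℝ) ^ 21 :=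
        pow_le_pow_of_le_one (by norm_num) (by norm_num) (by omega)
      have h2 : (1 / 7 : ℝ) ^ (k + 20 + 1) * r⁻¹ ≤ (1 / 7 : ℝ) ^ (k + 20 + 1) * 1 :=
        mul_le_mul_of_nonneg_left hrinv1 (by positivity)
      linarith
    have hnum0 : 0 ≤ 1 - (1 / 7 : ℝ) ^ 21 := by norm_num
    have hnum1 : (1 - (1 / 7 : ℝ) ^ 21) ^ 2 ≤ (1 - (1 / 7 : ℝ) ^ (k + 20 + 1) * r⁻¹) ^ 2 :=
      pow_le_pow_left₀ hnum0 (by linarith) 2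
    have hk : (0 : ℝ) ≤ k := Nat.cast_nonneg k
    have hden : (2 * ((k + 20 : ℕ) : ℝ) + 5 / 2) ^ 2 ≤ 4 * (((k : ℝ) + 85 / 4) * ((k : ℝ) + 85 / 4 + 1)) := by
      push_cast; nlinarith
    have hden0 : 0 < (2 * ((k + 20 : ℕ) : ℝ) + 5 / 2) ^ 2 := by positivity
    rw [show (1 - (1 / 7 : ℝ) ^ 21) ^ 2 / 4 * (1 / (((k : ℝ) + 85 / 4) * ((k : ℝ) + 85 / 4 + 1)))
        = (1 - (1 / 7 : ℝ) ^ 21) ^ 2 / (4 * (((k : ℝ) + 85 / 4) * ((k : ℝ) + 85 / 4 + 1))) by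
      field_simp]
    exact div_le_div₀ (by positivity) hnum1 hden0 hden
  rw [hTval] at htail
  have htailnum : (0.01176 : ℝ) ≤ (1 - (1 / 7 : ℝ) ^ 21) ^ 2 / 4 * (1 / (85 / 4)) := by norm_num
  have hsub : 4 * (r - 1) ^ 2 < 1.570395 := by nlinarith
  have hprime := prime_terms_half_log_seven_gt
  linarith

/-! ### Assembly -/

/-- **Anti-persistence on `[(log 5)/2, (log 7)/2]`** (prime powers `2, 3, 4, 5` acting): `Ψ(2s) < 2Ψ(s)`, by concavity
between the certified end-points `(log 5)/2` (`DbrWallAntipersistenceLogFive`) and `(log 7)/2`. [folklore] -/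
theorem zetaScrew_two_mul_lt_two_mul_of_half_log_five_le {s : ℝ} (h0 : Real.log 5 / 2 ≤ s)
    (h1 : s ≤ Real.log 7 / 2) : zetaScrew (2 * s) < 2 * zetaScrew s := by
  have hl2 : 0 < Real.log 2 := Real.log_pos one_lt_two
  have h25 : 2 * Real.log 2 < Real.log 5 := by
    have h' : Real.log 4 < Real.log 5 := Real.log_lt_log (by norm_num) (by norm_num)
    have h4 : Real.log 4 = 2 * Real.log 2 := by
      rw [show (4 : ℝ) = 2 ^ 2 by norm_num, Real.log_pow]; norm_num
    linarith
  have h57 : Real.log 5 < Real.log 7 := Real.log_lt_log (by norm_num) (by norm_num)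
  obtain ⟨s₀, hs₀⟩ : ∃ s₀ : ℝ, s₀ = Real.log 5 / 2 := ⟨_, rfl⟩
  obtain ⟨s₁, hs₁⟩ : ∃ s₁ : ℝ, s₁ = Real.log 7 / 2 := ⟨_, rfl⟩
  rw [← hs₀] at h0
  rw [← hs₁] at h1
  have hd : 0 < s₁ - s₀ := by rw [hs₀, hs₁]; linarith
  set a : ℝ := (s₁ - s) / (s₁ - s₀) with ha
  set b : ℝ := (s - s₀) / (s₁ - s₀) with hb
  have ha0 : 0 ≤ a := div_nonneg (by linarith) hd.le
  have hb0 : 0 ≤ b := div_nonneg (by linarith) hd.le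
  have hab : a + b = 1 := by rw [ha, hb, ← add_div, div_eq_one_iff_eq hd.ne']; ring
  have hs : a * s₀ + b * s₁ = s := by
    rw [ha, hb]; field_simp; ring
  have hc := gap_add_prime_concave (x := s₀) (y := s₁) (by rw [hs₀]; linarith) (by rw [hs₁]; linarith)
    ha0 hb0 hab
  rw [hs] at hc
  have hlin : a * (Real.log 3 / Real.sqrt 3 * (2 * s₀ - Real.log 3) + Real.log 2 / 2 * (2 * s₀ - Real.log 4)
        + Real.log 5 / Real.sqrt 5 * (2 * s₀ - Real.log 5) - 2 * (Real.log 2 / Real.sqrt 2 * (s₀ - Real.log 2)))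
      + b * (Real.log 3 / Real.sqrt 3 * (2 * s₁ - Real.log 3) + Real.log 2 / 2 * (2 * s₁ - Real.log 4)
        + Real.log 5 / Real.sqrt 5 * (2 * s₁ - Real.log 5) - 2 * (Real.log 2 / Real.sqrt 2 * (s₁ - Real.log 2)))
      = Real.log 3 / Real.sqrt 3 * (2 * s - Real.log 3) + Real.log 2 / 2 * (2 * s - Real.log 4)
        + Real.log 5 / Real.sqrt 5 * (2 * s - Real.log 5) - 2 * (Real.log 2 / Real.sqrt 2 * (s - Real.log 2)) := by
    have hb' : b = 1 - a := by linarith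
    rw [← hs, hb']; ring
  have hF0 : 0 < (∑' k : ℕ, (1 - Real.exp (-((2 * (k : ℝ) + 5 / 2) * s₀))) ^ 2 / (2 * (k : ℝ) + 5 / 2) ^ 2)
      - 4 * (Real.exp (s₀ / 2) - 1) ^ 2 + Real.log 2 / Real.sqrt 2 * (2 * s₀ - Real.log 2)
      + Real.log 3 / Real.sqrt 3 * (2 * s₀ - Real.log 3) + Real.log 2 / 2 * (2 * s₀ - Real.log 4)
      + Real.log 5 / Real.sqrt 5 * (2 * s₀ - Real.log 5)
      - 2 * (Real.log 2 / Real.sqrt 2 * (s₀ - Real.log 2)) := by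
    have h := gap_add_primes_half_log_five_pos
    rw [← hs₀] at h
    have hz : Real.log 5 / Real.sqrt 5 * (2 * s₀ - Real.log 5) = 0 := by rw [hs₀]; ring
    linarith
  have hF1 : 0 < (∑' k : ℕ, (1 - Real.exp (-((2 * (k : ℝ) + 5 / 2) * s₁))) ^ 2 / (2 * (k : ℝ) + 5 / 2) ^ 2)
      - 4 * (Real.exp (s₁ / 2) - 1) ^ 2 + Real.log 2 / Real.sqrt 2 * (2 * s₁ - Real.log 2)
      + Real.log 3 / Real.sqrt 3 * (2 * s₁ - Real.log 3) + Real.log 2 / 2 * (2 * s₁ - Real.log 4)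
      + Real.log 5 / Real.sqrt 5 * (2 * s₁ - Real.log 5)
      - 2 * (Real.log 2 / Real.sqrt 2 * (s₁ - Real.log 2)) := by
    have h := gap_add_primes_half_log_seven_pos
    rw [← hs₁] at h
    exact h
  have hid := two_mul_zetaScrew_sub_eq_gap_add_four_primes (s := s) (by rw [hs₀] at h0; linarith)
    (by rw [hs₁] at h1; linarith)
  have hmin : 0 < a * ((∑' k : ℕ, (1 - Real.exp (-((2 * (k : ℝ) + 5 / 2) * s₀))) ^ 2
        / (2 * (k : ℝ) + 5 / 2) ^ 2)
      - 4 * (Real.exp (s₀ / 2) - 1) ^ 2 + Real.log 2 / Real.sqrt 2 * (2 * s₀ - Real.log 2)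
      + Real.log 3 / Real.sqrt 3 * (2 * s₀ - Real.log 3) + Real.log 2 / 2 * (2 * s₀ - Real.log 4)
      + Real.log 5 / Real.sqrt 5 * (2 * s₀ - Real.log 5)
      - 2 * (Real.log 2 / Real.sqrt 2 * (s₀ - Real.log 2)))
      + b * ((∑' k : ℕ, (1 - Real.exp (-((2 * (k : ℝ) + 5 / 2) * s₁))) ^ 2
        / (2 * (k : ℝ) + 5 / 2) ^ 2)
      - 4 * (Real.exp (s₁ / 2) - 1) ^ 2 + Real.log 2 / Real.sqrt 2 * (2 * s₁ - Real.log 2)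
      + Real.log 3 / Real.sqrt 3 * (2 * s₁ - Real.log 3) + Real.log 2 / 2 * (2 * s₁ - Real.log 4)
      + Real.log 5 / Real.sqrt 5 * (2 * s₁ - Real.log 5)
      - 2 * (Real.log 2 / Real.sqrt 2 * (s₁ - Real.log 2))) := by
    rcases le_total a b with hab' | hab'
    · have hb2 : 1 / 2 ≤ b := by linarith
      have e1 := mul_nonneg ha0 hF0.le
      have e2 := mul_le_mul_of_nonneg_right hb2 hF1.le
      linarith
    · have ha2 : 1 / 2 ≤ a := by linarith
      have e1 := mul_nonneg hb0 hF1.le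
      have e2 := mul_le_mul_of_nonneg_right ha2 hF0.le
      linarith
  linarith

/-- **Anti-persistence of the zeta screw line for every mesh up to `(log 7)/2`** (RH-FREE calculus inequality):
`Ψ(2s) < 2Ψ(s)` for every `0 < s ≤ (log 7)/2`. [folklore] -/
theorem zetaScrew_two_mul_lt_two_mul_of_le_half_log_seven {s : ℝ} (hs0 : 0 < s)
    (hs : s ≤ Real.log 7 / 2) : zetaScrew (2 * s) < 2 * zetaScrew s := by
  rcases le_total s (Real.log 5 / 2) with h | h
  · exact zetaScrew_two_mul_lt_two_mul_of_le_half_log_five hs0 h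
  · exact zetaScrew_two_mul_lt_two_mul_of_half_log_five_le h hs

/-- **Negative lag-one increment covariance for every mesh up to `(log 7)/2`**: `c₁(s) = Ψ(2s) − 2Ψ(s) + Ψ(0) < 0`.
[folklore] -/
theorem lagOne_increment_cov_neg_of_le_half_log_seven {s : ℝ} (hs0 : 0 < s) (hs : s ≤ Real.log 7 / 2) :
    zetaScrew (2 * s) - 2 * zetaScrew s + zetaScrew 0 < 0 := by
  have h := zetaScrew_two_mul_lt_two_mul_of_le_half_log_seven hs0 hs
  rw [zetaScrew_zero]
  linarith

end Summit.RiemannHypothesis.RiemannHypothesis.Theorems.DbrWall
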